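import Mathlib
import Literature.Computability.AlgebraicComplexity.MatrixMultiplicationExponent

/-!
# Line `separable-majorant` for crux `FidelityWitnesses.FidelityThesis` (stmt-MatrixMultiplication-4956) —
toolkit I: output slices of `⟨n,n,n⟩` and the SINGLE-PRODUCT LAW

Conventions (tree `matMulTensor`): slots `a = (κ,ν)` (output), `b = (κ,μ)`, `c = (μ',ν)` in `Fin n × Fin n`,
`⟨n,n,n⟩(a,b,c) = [a.1 = b.1 ∧ b.2 = c.1 ∧ a.2 = c.2]`.  The output slice `T_a := ⟨n,n,n⟩(a,·,·)` is the
indicator of `{((a.1,m),(m,a.2)) : m}`; pairing a product `u ⊗ v` against it reads off the matrix entry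
`(UV)_{a} = Σ_m u(a.1,m) v(m,a.2)`, so

  `Σ_a |⟨u ⊗ v, T_a⟩|² = ‖U V‖_F² ≤ ‖u‖² ‖v‖²`     (single-product law, `M(n,1) = 1` in slice form),

uniformly in `n`: a unit product vector "sees" at most one of the `n³` units of `⟨n,n,n⟩`.  This is the only
input from `⟨n,n,n⟩` that the separable-majorant line uses (idea card
`Cruxes/FidelityThesis/Ideas/separable-majorant-law.md`, § Lever; line lead's skeleton
`Cruxes/FidelityThesis/Lines/Sketch.lean`).  Supports item `stmt-MatrixMultiplication-4956`; no definitions; imports `Literature` only.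
-/

namespace Summit.MatrixMultiplication.MatrixMultiplication.Theorems

open scoped BigOperators ComplexConjugate
open Literature.Computability.AlgebraicComplexity

/-- Cauchy–Schwarz for a finite complex sum over a finite type: `|Σ_i f g|² ≤ (Σ_i |f|²) (Σ_i |g|²)`.  (Double
sums over `(a, l)` reduce to this by `Fintype.sum_prod_type`.) [folklore] -/
theorem sepMajorant_cauchySchwarz {ι : Type*} [Fintype ι] (f g : ι → ℂ) :
    ‖∑ i, f i * g i‖ ^ 2 ≤ (∑ i, ‖f i‖ ^ 2) * ∑ i, ‖g i‖ ^ 2 := by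
  have h1 : ‖∑ i, f i * g i‖ ≤ ∑ i, ‖f i‖ * ‖g i‖ := by
    calc ‖∑ i, f i * g i‖ ≤ ∑ i, ‖f i * g i‖ := norm_sum_le _ _
      _ = ∑ i, ‖f i‖ * ‖g i‖ := by simp_rw [norm_mul]
  calc ‖∑ i, f i * g i‖ ^ 2 ≤ (∑ i, ‖f i‖ * ‖g i‖) ^ 2 :=
        pow_le_pow_left₀ (norm_nonneg _) h1 2
    _ ≤ (∑ i, ‖f i‖ ^ 2) * ∑ i, ‖g i‖ ^ 2 := Finset.sum_mul_sq_le_sq_mul_sq _ _ _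

/-- **Output slices of `⟨n,n,n⟩`** (general `n`): pairing any `F` against the slice `⟨n,n,n⟩(a,·,·)` reads
off `Σ_m F (a.1,m) (m,a.2)`.  (The `n = 2` case is `SevenEighthsLaw.slice_sum_matMulTensor`; same proof.)
[folklore] -/
theorem sepMajorant_slice_sum_matMulTensor {n : ℕ} (F : (Fin n × Fin n) → (Fin n × Fin n) → ℂ)
    (a : Fin n × Fin n) :
    ∑ b, ∑ c, F b c * matMulTensor ℂ n n n a b c = ∑ m : Fin n, F (a.1, m) (m, a.2) := by
  have inner : ∀ b : Fin n × Fin n,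
      (∑ c, F b c * matMulTensor ℂ n n n a b c) = if a.1 = b.1 then F b (b.2, a.2) else 0 := by
    intro b
    by_cases hb : a.1 = b.1
    · rw [if_pos hb, Finset.sum_eq_single (b.2, a.2)]
      · simp [matMulTensor, hb]
      · intro c _ hc
        simp only [matMulTensor]
        rw [if_neg, mul_zero]
        rintro ⟨-, h2, h3⟩
        exact hc (Prod.ext h2.symm h3.symm)
      · intro h; exact absurd (Finset.mem_univ _) h
    · rw [if_neg hb]
      refine Finset.sum_eq_zero fun c _ => ?_
      simp only [matMulTensor]
      rw [if_neg (fun h => hb h.1), mul_zero]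
  simp_rw [inner]
  rw [Fintype.sum_prod_type, Finset.sum_comm]
  refine Finset.sum_congr rfl fun m _ => ?_
  rw [Finset.sum_ite_eq]
  simp

/-- Pairing a product `u ⊗ v` against the output slice `⟨n,n,n⟩(a,·,·)` gives the matrix-product entry
`(UV)_a = Σ_m u (a.1,m) · v (m,a.2)`. [folklore] -/
theorem sepMajorant_product_slice {n : ℕ} (u v : Fin n × Fin n → ℂ) (a : Fin n × Fin n) :
    ∑ b, ∑ c, u b * v c * matMulTensor ℂ n n n a b c = ∑ m : Fin n, u (a.1, m) * v (m, a.2) :=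
  sepMajorant_slice_sum_matMulTensor (fun b c => u b * v c) a

/-- **Single-product law** (`M(n,1) = 1` in slice form, uniform in `n`): for every `u, v ∈ ℂ^{n×n}`,
`Σ_a |⟨u ⊗ v, ⟨n,n,n⟩(a,·,·)⟩|² = ‖UV‖_F² ≤ ‖u‖²·‖v‖²` — a product vector of the two input legs overlaps the
`n³` units of `⟨n,n,n⟩` with total weight at most its own norm.  Card `separable-majorant-law`, § Lever,
"`⟨x|W|x⟩ = ‖ÛV̂‖_F² ≤ 1`". [folklore] -/
theorem sepMajorant_singleProductLaw {n : ℕ} (u v : Fin n × Fin n → ℂ) :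
    ∑ a : Fin n × Fin n, ‖∑ b, ∑ c, u b * v c * matMulTensor ℂ n n n a b c‖ ^ 2 ≤
      (∑ b, ‖u b‖ ^ 2) * ∑ c, ‖v c‖ ^ 2 := by
  -- entrywise Cauchy–Schwarz for `(UV)_a = Σ_m u(a.1,m) v(m,a.2)` (as in `RankTwoAdditivity.norm_sq_mul_le`)
  have hrow : ∀ a : Fin n × Fin n, ‖∑ b, ∑ c, u b * v c * matMulTensor ℂ n n n a b c‖ ^ 2 ≤
      (∑ m, ‖u (a.1, m)‖ ^ 2) * ∑ m, ‖v (m, a.2)‖ ^ 2 := by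
    intro a
    rw [sepMajorant_product_slice u v a]
    exact sepMajorant_cauchySchwarz (fun m => u (a.1, m)) (fun m => v (m, a.2))
  set U : Fin n → ℝ := fun i => ∑ m, ‖u (i, m)‖ ^ 2 with hU
  set V : Fin n → ℝ := fun y => ∑ m, ‖v (m, y)‖ ^ 2 with hV
  have hUsum : ∑ i, U i = ∑ b, ‖u b‖ ^ 2 := by
    rw [Fintype.sum_prod_type (f := fun b => ‖u b‖ ^ 2)]
  have hVsum : ∑ y, V y = ∑ c, ‖v c‖ ^ 2 := by
    rw [Fintype.sum_prod_type (f := fun c => ‖v c‖ ^ 2), Finset.sum_comm]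
  calc (∑ a : Fin n × Fin n, ‖∑ b, ∑ c, u b * v c * matMulTensor ℂ n n n a b c‖ ^ 2)
      ≤ ∑ a : Fin n × Fin n, U a.1 * V a.2 := Finset.sum_le_sum fun a _ => hrow a
    _ = ∑ i, ∑ y, U i * V y := by rw [Fintype.sum_prod_type]
    _ = (∑ i, U i) * ∑ y, V y := (Fintype.sum_mul_sum U V).symm
    _ = (∑ b, ‖u b‖ ^ 2) * ∑ c, ‖v c‖ ^ 2 := by rw [hUsum, hVsum]

/-- If `‖u‖²·‖v‖² = 0` the single-product pairings all vanish (`u = 0` or `v = 0`). [folklore] -/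
theorem sepMajorant_product_slice_eq_zero {n : ℕ} (u v : Fin n × Fin n → ℂ)
    (h : (∑ b, ‖u b‖ ^ 2) * (∑ c, ‖v c‖ ^ 2) = 0) (a : Fin n × Fin n) :
    ∑ b, ∑ c, u b * v c * matMulTensor ℂ n n n a b c = 0 := by
  have := sepMajorant_singleProductLaw u v
  rw [h] at this
  have hz := (Finset.sum_eq_zero_iff_of_nonneg (fun a _ => by positivity)).mp
    (le_antisymm this (Finset.sum_nonneg fun a _ => by positivity)) a (Finset.mem_univ a)
  exact norm_eq_zero.mp (pow_eq_zero_iff (n := 2) (by norm_num) |>.mp hz)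

/-- The pairing of a sum of `r` triads `Σ_l w_l ⊗ u_l ⊗ v_l` with `⟨n,n,n⟩`, slice by slice:
`⟨S, ⟨n,n,n⟩⟩ = Σ_a Σ_l w_l(a) · (U_l V_l)_a`. [folklore] -/
theorem sepMajorant_frame_pairing {n r : ℕ} (w u v : Fin r → Fin n × Fin n → ℂ) :
    ∑ a, ∑ b, ∑ c, (∑ l, w l a * u l b * v l c) * matMulTensor ℂ n n n a b c =
      ∑ a : Fin n × Fin n, ∑ l, w l a * ∑ m : Fin n, u l (a.1, m) * v l (m, a.2) := by
  refine Finset.sum_congr rfl fun a _ => ?_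
  rw [sepMajorant_slice_sum_matMulTensor (fun b c => ∑ l, w l a * u l b * v l c) a]
  calc ∑ m : Fin n, ∑ l, w l a * u l (a.1, m) * v l (m, a.2)
      = ∑ l, ∑ m : Fin n, w l a * u l (a.1, m) * v l (m, a.2) := Finset.sum_comm
    _ = ∑ l, w l a * ∑ m : Fin n, u l (a.1, m) * v l (m, a.2) := by
        refine Finset.sum_congr rfl fun l _ => ?_
        rw [Finset.mul_sum]
        exact Finset.sum_congr rfl fun m _ => by ring

/-- The output slice `a` of a sum of triads paired with `⟨n,n,n⟩(a,·,·)`, with the coefficients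
`d_l := w_l(a)` frozen: `Σ_{b,c} (Σ_l d_l u_l(b) v_l(c)) ⟨n,n,n⟩(a,b,c) = Σ_l d_l (U_l V_l)_a`. [folklore] -/
theorem sepMajorant_slice_pairing {n r : ℕ} (d : Fin r → ℂ) (u v : Fin r → Fin n × Fin n → ℂ)
    (a : Fin n × Fin n) :
    ∑ b, ∑ c, (∑ l, d l * u l b * v l c) * matMulTensor ℂ n n n a b c =
      ∑ l, d l * ∑ m : Fin n, u l (a.1, m) * v l (m, a.2) := by
  rw [sepMajorant_slice_sum_matMulTensor (fun b c => ∑ l, d l * u l b * v l c) a]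
  calc ∑ m : Fin n, ∑ l, d l * u l (a.1, m) * v l (m, a.2)
      = ∑ l, ∑ m : Fin n, d l * u l (a.1, m) * v l (m, a.2) := Finset.sum_comm
    _ = ∑ l, d l * ∑ m : Fin n, u l (a.1, m) * v l (m, a.2) := by
        refine Finset.sum_congr rfl fun l _ => ?_
        rw [Finset.mul_sum]
        exact Finset.sum_congr rfl fun m _ => by ring

end Summit.MatrixMultiplication.MatrixMultiplication.Theorems
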